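import Summits.BirchSwinnertonDyer.BirchSwinnertonDyer.Theses.ThetaPartnerAtTwo
import Summits.BirchSwinnertonDyer.BirchSwinnertonDyer.Theorems.ThetaPartnerAtTwoSignedKatoUpToAtTwoKatoBKCoreKZLit
import Summits.BirchSwinnertonDyer.BirchSwinnertonDyer.Theorems.ThetaPartnerAtTwoSignedKatoUpToAtTwoOfPubKBK
import Summits.BirchSwinnertonDyer.BirchSwinnertonDyer.Theorems.ThetaPartnerAtTwoSignedKatoUpToAtTwoKatoBKBricks
import Summits.BirchSwinnertonDyer.BirchSwinnertonDyer.Theorems.ThetaPartnerAtTwoSignedKatoUpToAtTwoCorePairCertificates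
import HarnessLib

/-!
# Route `ThetaPartnerAtTwo` (TP2) — closer of the KZ-window child C `SignedKatoDivisibilityUpToAtTwoOfPubOfKatoFact`
# (item stmt-BirchSwinnertonDyer-22681; split gen 1 of K3P′ stmt-BirchSwinnertonDyer-25631, route rev 47)

HONEST FRAMING (cell `pub/bsd-wall`, W-ALL row 1 TP2 K3 column; lead prover `bsd-wall-tp2-p2x` g11).
The route item C `SignedKatoDivisibilityUpToAtTwoOfPubOfKatoFact := KatoEulerSystemTatePairingValuesTwoInput →
SignedKatoDivisibilityUpToAtTwoOfPub` is closed BY NAME by the kernel chain of line `colemanrat` v16 — the SAME term as the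
landed one-hypothesis certificate p642700 `SignedKatoOffTwo.KatoBK.signedKatoDivisibilityUpToAtTwoOfPub_of_kato_tatePairing_fact`
(lead tp2-p2x g8), spelt out here over its route-independent constituents so that this closer's import cone contains no
second route file: `KatoBK.coreKZ_of_coreKZLit` (p640162) → `KatoBK.corePairChiPrim_of_coreKZ_of_bricks` (w3 g8) with the four
unconditional bricks `cuspBrick_unconditional` (Rohrlich's theorem is the tree THEOREM `Rohrlich1984_nonvanishing_twists_holds`),
`heckeBaseTwo_brick`, `logBaseTwo_brick`, `katoTrivialValuesTwo_brick` → `CoreChi.signedKatoDivisibilityUpToAtTwoOfPub_of_corePairChiPrim`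
(w3 g6). Its displayed hypothesis is the HOLD item H `KatoEulerSystemTatePairingValuesTwoInput` := the Literature fact
`Literature.NumberTheory.EllipticCurves.Kato2004.exists_eulerSystem_expStar_tatePairing_values_two` BY NAME (p640688).
Nothing here discharges H (a PUBLISHED INPUT: Kato 2004 Thm. 12.5 (1) with the explicit reciprocity law at `p = 2`, read on
the layer Tate pairing; Rubin 1998 §5; Kobayashi 2003 (8.23)); K3P′ 25631 then reads «⟸ H (HOLD)» by the split glue
(item stmt-BirchSwinnertonDyer-22682). K3 / K3P′ are NOT settled by this; BSD is NOT proved by any of this.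
-/

set_option autoImplicit false
-- the Theorems namespace of this sub repeats the summit name by design (D-0017 nested layout)
set_option linter.dupNamespace false

open Literature.NumberTheory.EllipticCurves Literature.NumberTheory.EllipticCurves.Kato2004

namespace Summit.BirchSwinnertonDyer.BirchSwinnertonDyer.Theorems

/-- **C BY NAME** (item stmt-BirchSwinnertonDyer-22681): the route decl `SignedKatoDivisibilityUpToAtTwoOfPubOfKatoFact`
(Kato's `2`-adic Euler-system / Tate-pairing value package H → K3P′) holds — the kernel chain of line `colemanrat` v16
(`coreKZ_of_coreKZLit` → CORE_KZ socket with the four unconditional bricks → `CoreChi.…OfPub_of_corePairChiPrim`), i.e.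
the term of the landed certificate p642700 `KatoBK.signedKatoDivisibilityUpToAtTwoOfPub_of_kato_tatePairing_fact`.
CONDITIONAL on nothing beyond its own antecedent H (HOLD, published input); BSD is not proved by this.
[cite: Kato2004Asterisque, Thm. 12.5 (1) (pp. 221–222), Ex. 13.3 (p. 225), Thm. 13.4 (2) (p. 226)]
[cite: Rubin1998Durham, §5 display (2), Thm. 7.1] [cite: Kobayashi2003, (8.23), (8.29), Prop. 8.25] -/
theorem signedKatoDivisibilityUpToAtTwoOfPubOfKatoFact_proof :
    Summit.BirchSwinnertonDyer.BirchSwinnertonDyer.Theses.ThetaPartnerAtTwo.SignedKatoDivisibilityUpToAtTwoOfPubOfKatoFact := by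
  unfold Summit.BirchSwinnertonDyer.BirchSwinnertonDyer.Theses.ThetaPartnerAtTwo.SignedKatoDivisibilityUpToAtTwoOfPubOfKatoFact
    Summit.BirchSwinnertonDyer.BirchSwinnertonDyer.Theses.ThetaPartnerAtTwo.KatoEulerSystemTatePairingValuesTwoInput
  intro hF
  exact SignedKatoOffTwo.CoreChi.signedKatoDivisibilityUpToAtTwoOfPub_of_corePairChiPrim
    (SignedKatoOffTwo.KatoBK.corePairChiPrim_of_coreKZ_of_bricks (SignedKatoOffTwo.KatoBK.coreKZ_of_coreKZLit hF)
      SignedKatoOffTwo.KatoBK.cuspBrick_unconditional SignedKatoOffTwo.KatoBK.heckeBaseTwo_brick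
      SignedKatoOffTwo.KatoBK.logBaseTwo_brick SignedKatoOffTwo.KatoBK.katoTrivialValuesTwo_brick)

end Summit.BirchSwinnertonDyer.BirchSwinnertonDyer.Theorems
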